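import Mathlib
import HarnessLib

/-!
# Magnen–Rivasseau–Sénéor, *Construction of YM₄ with an infrared cutoff* (CMP 155, 1993), §II.C p.341 — the linear
# part `T(γ)` of the truncated gauge transformation `A ↦ A^{γ,2}` in su(2): (II.41) `T_ab(γ) = δ_ab − ε_abc λγ_c`,
# its inverse (II.42) and the Jacobian (II.43) `J(γ) = (1 + λ²γ²)⁻¹`, PROVED as printed

statement-level reproduction of three printed algebraic identities, kernel-checked; nothing here is a claim about
the Yang–Mills mass gap, about continuum Yang–Mills on `T⁴`, or about the Clay problem

**Citation header (reproduction of PUBLISHED work).** J. Magnen, V. Rivasseau, R. Sénéor, *Construction of YM₄ with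
an infrared cutoff*, Commun. Math. Phys. **155** (1993) 325–383 [MagnenRivasseauSeneor1993], Sect. II.C «The
Modified Homothetic Gauge in the Background Field», p.341, displays (II.41)–(II.43), with the su(2) conventions of
Sect. II.A p.328. Loci `p.NNN tl.nn` = journal page and text-layer line of the held Project-Euclid scan
`paper:magnen1993-cmp155-mrs-ym4-infrared-cutoff` (PDF page = journal page − 324); the displays were read on the
decoded page image (crop `renders/p17_crop_r1750-4100_s2.png` in the seat folder of unit `pub-balaban-gaps-mrs-lit-1`;
renders of record `run/shared/lean/pub/lit-balaban/inprint/lit-balaban-p14/renders-cmp155/`). Cell pub-balaban-gaps,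
track G3, seat mrs-lit-1; companion prose `run/shared/lean/pub/pub-balaban-gaps/g3/MRS-AS-PRINTED.md`. Siblings:
`…MRS93StartingAnsatz` ((II.11)–(II.15)), `…MRS93MainStatement` (p.327), `…MRS93OneLoopCounterterms` (Sect. III).

**What the paper prints (verbatim).**
* p.328 tl.26–33 (conventions): *«A = Σ_{a=1}^{3} A^a t_a, with t_a = (iσ_a/2), where the σ's are the three usual
  hermitian Pauli matrices. With this convention the covariant derivative is D_μ = ∂_μ − λ[A_μ, ·] We have
  Tr t_a t_b = −δ_ab/2. … Remark that in the three dimensional su(2) space, the commutator is a wedge product: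
  [A^a_μ, A^b_ν] = ε^c_{ab} A^a_μ A^b_ν.»* (i.e. the `c`-component of `[A_μ, A_ν]` is `Σ_{ab} ε_cab A^a_μ A^b_ν`).
* (II.1)–(II.2) p.328 tl.29–35: *«The field curvature is: F_μν = (∂_μA_ν − ∂_νA_μ) − λ[A_μ, A_ν] = (∂ ∧ A − λ[A, A]),
  (II.1) λ being the coupling constant … The pure Yang-Mills action is: −½ ∫_Λ d⁴x Tr F_μν F^μν = ¼ ∫_Λ d⁴x Σ_a
  F^a_μν F^{μνa} (II.2)»*; p.328 tl.37–41: *«we define a scalar product ⟨A, B⟩ on space time tensors A and B of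
  the same type with values in the Lie algebra, by the convention that a trace is taken over all correspondent space
  time indices and minus a trace over group indices, so that it is positive definite with a factor 1/2 in component
  notation.»*
* (II.6) p.329 tl.15–16: *«A^{γ,2}_μ = A_μ + D_μγ + λ/2[γ, ∂_μγ]. (II.6) This "truncated" gauge transformed
  configuration A^{γ,2} is a polynomial of second order in γ and its derivatives.»*
* p.341 tl.14–22: *«Remark that this change of variables is one to one, namely it is possible to compute directly
  the initial field A in terms of A′, since the transformation A → A^{γ,2} is invertible. The inversion formula
  exists (also for higher orders approximations to true gauge transformations) and is a rational function of γ. …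
  For instance, if we write A′ = A^{γ,2} = T(γ).A + U(γ), with T.A = A − λ[A, γ] and U = ∂γ + 1/2[γ, ∂γ], in
  su(2) space the matrix of T is T_ab(γ) = δ_ab − ε_abc λγ_c. (II.41)»* (the lead-in prints «1/2[γ, ∂γ]» where
  (II.6) has «λ/2»; `U` plays no role below).
* (II.42) p.341 tl.23–26: *«Its inverse is T⁻¹_ab = (1/(1 + λ² Σ_d γ_d²)) (δ_ab + ε_abc λγ_c + λ²γ_aγ_b) = δ_ab +
  H_ab, (II.42) where H is a small matrix; the transformation A → A′ is therefore inverted by A = T⁻¹(A′ − U).»*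
* (II.43) p.341 tl.27–33: *«Furthermore the Jacobian of the change of variables associated to a true gauge
  transformation is one, since the linear piece is an inner automorphism. For the truncated gauge transformation
  this is no longer exactly true. For instance for the truncated transformation A → A^{γ,2} the linear piece is
  A → TA, and the Jacobian is J(γ) ≡ (1 + λ²γ²)⁻¹. The formal Lebesgue measure changes therefore, if A′ = A^{γ,2}
  as: Π_x dA(x) → Π_x dA′(x) Π_x (1 + λ²γ²(x))⁻¹. (II.43)»*

**What is reproduced here (kernel-checked, zero `sorry`, zero named facts).** At a point `x`, `γ = γ(x) ∈ su(2) ≅ ℝ³`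
and the colour components of one Lorentz component `A_μ(x) ∈ ℝ³`; everything is `3 × 3` real linear algebra:
* `eps a b c` = the Levi-Civita symbol `ε_abc` and `bracket X Y` = the su(2) commutator in components,
  `[X, Y]^a = ε_abc X^b Y^c` (p.328), identified with Mathlib's cross product (`bracket_eq_crossProduct`);
* `Tmat λ γ` = (II.41) literally (`δ_ab − Σ_c ε_abc λγ_c`), `Tmat_mulVec` : `T.A = A − λ[A, γ]` (the printed
  definition of `T`), `Tmat_eq` (the explicit matrix);
* `TinvMat λ γ` = the middle member of (II.42) literally, **`Tmat_mul_TinvMat`** / **`TinvMat_mul_Tmat`**: it IS the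
  two-sided inverse, for every real `λ` and `γ` (the prefactor `1 + λ²Σγ_d²` never vanishes over `ℝ`), hence
  `Tmat_inv : (Tmat λ γ)⁻¹ = TinvMat λ γ` (Mathlib's matrix inverse) — the printed «one to one … invertible … a
  rational function of γ»; `Hmat` = `H` of (II.42) with `TinvMat_eq_one_add_Hmat` and the explicit numerator
  `Hmat_eq` (`H = (λ ε_abc γ_c + λ²(γ_aγ_b − δ_ab Σγ_d²))/(1 + λ²Σγ_d²)`, which is what makes it «small» with `λγ`);
* **`det_Tmat`** : `det T(γ) = 1 + λ² Σ_d γ_d²` and `det_TinvMat : det T⁻¹ = (1 + λ²Σ_dγ_d²)⁻¹` = the printed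
  `J(γ)` (`jacobianJ`, `det_TinvMat_eq_jacobianJ`): the factor `(1 + λ²γ²(x))⁻¹` of (II.43) is the determinant of
  the INVERSE linear piece `A′ ↦ A = T⁻¹A′` (so `dA = J dA′`, as (II.43) prints), and `det T · J = 1`.

**v1.1 (same seat, append-only + one docstring made verbatim).** §su(2): the matrix conventions of Sect. II.A
p.328 behind `bracket`, kernel-checked on `2 × 2` complex matrices: `Su2Conventions.pauli` («the three usual
hermitian Pauli matrices»: `pauli_conjTranspose`, `pauli_trace`), `tgen a = (iσ_a/2)` = the printed `t_a`,
**`trace_tgen_mul`**: «Tr t_a t_b = −δ_ab/2» EXACTLY AS PRINTED; `toSu2 A = Σ_a A^a t_a`; **`neg_trace_toSu2_mul`**: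
`−Tr(AB) = ½ Σ_a A^a B^a` (the scalar product «minus a trace over group indices, so that it is positive definite with
a factor 1/2 in component notation», p.328 tl.37–41) and **`actionDensity_II2`**: `−½ Tr(F F) = ¼ Σ_a (F^a)²` (the
integrand identity of (II.2)). PRECISION (ours, kernel-checked, flagged not fixed): with `t_a = iσ_a/2` as printed
the structure constants come out as `[t_a, t_b] = −ε_abc t_c` (`tgen_commutator`), hence
`[A, B] = −Σ_c (bracket A B)_c t_c` (`toSu2_commutator`) — the OPPOSITE sign to the printed wedge-product sentence
«[A^a_μ, A^b_ν] = ε^c_{ab} A^a_μ A^b_ν»; the printed sign is that of the generators `σ_a/(2i) = −iσ_a/2`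
(`tgen'_commutator`: `[t′_a, t′_b] = +ε_abc t′_c`). Equivalently the two conventions differ by `λ ↦ −λ` in (II.1);
we record the discrepancy between two printed lines of p.328 and do not adjudicate which sign the later sections use
(`bracket`, `Tmat` follow the printed wedge-product sentence and (II.41) literally).

**What is NOT claimed.** The infinite product over `x` in (II.43) and its Gaussian analogue (II.44)–(II.45); the
inversion formulas for the higher truncations `A^{γ,n}`; anything about `U(γ)` or the functional integrals; which
sign convention Sects. III–VIII effectively use.
-/

namespace Literature.MathematicalPhysics.QuantumFieldTheory.MagnenRivasseauSeneor1993

namespace TruncatedGauge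

open Matrix

/-- The Levi-Civita symbol `ε_abc` on three colour indices (`ε_012 = 1`, totally antisymmetric), indices `0,1,2`
for the print's `1,2,3`. [cite: MagnenRivasseauSeneor1993, §II.A p.328] -/
def eps (a b c : Fin 3) : ℝ :=
  if a = 0 ∧ b = 1 ∧ c = 2 ∨ a = 1 ∧ b = 2 ∧ c = 0 ∨ a = 2 ∧ b = 0 ∧ c = 1 then 1
  else if a = 0 ∧ b = 2 ∧ c = 1 ∨ a = 2 ∧ b = 1 ∧ c = 0 ∨ a = 1 ∧ b = 0 ∧ c = 2 then -1
  else 0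

/-- The su(2) commutator in colour components, as the print defines it: *«in the three dimensional su(2) space,
the commutator is a wedge product: [A^a_μ, A^b_ν] = ε^c_{ab} A^a_μ A^b_ν»* (p.328 tl.32–33) — component `a` of
`bracket X Y` is `Σ_{bc} ε_abc X_b Y_c`. [cite: MagnenRivasseauSeneor1993, §II.A p.328] -/
def bracket (X Y : Fin 3 → ℝ) : Fin 3 → ℝ := fun a => ∑ b, ∑ c, eps a b c * X b * Y c

/-- The printed «wedge product» is Mathlib's cross product on `ℝ³`. [cite: MagnenRivasseauSeneor1993, §II.A p.328] -/
theorem bracket_eq_crossProduct (X Y : Fin 3 → ℝ) : bracket X Y = crossProduct X Y := by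
  ext a
  rw [cross_apply]
  fin_cases a <;> simp [bracket, eps, Fin.sum_univ_three] <;> ring

/-- The bracket is antisymmetric. [cite: MagnenRivasseauSeneor1993, §II.A p.328] -/
theorem bracket_swap (X Y : Fin 3 → ℝ) : bracket Y X = -bracket X Y := by
  ext a
  fin_cases a <;> simp [bracket, eps, Fin.sum_univ_three] <;> ring

/-- (II.41): *«in su(2) space the matrix of T is T_ab(γ) = δ_ab − ε_abc λγ_c»* (sum over `c`).
[cite: MagnenRivasseauSeneor1993, (II.41) p.341] -/
def Tmat (lam : ℝ) (γ : Fin 3 → ℝ) : Matrix (Fin 3) (Fin 3) ℝ :=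
  Matrix.of fun a b => (if a = b then 1 else 0) - ∑ c, eps a b c * lam * γ c

/-- `T` is the linear piece of `A ↦ A^{γ,2}`: *«T.A = A − λ[A, γ]»* (p.341 tl.20).
[cite: MagnenRivasseauSeneor1993, (II.41) p.341] -/
theorem Tmat_mulVec (lam : ℝ) (γ A : Fin 3 → ℝ) :
    (Tmat lam γ).mulVec A = A - lam • bracket A γ := by
  ext a
  simp only [Tmat, mulVec, dotProduct, Matrix.of_apply, Pi.sub_apply, Pi.smul_apply, smul_eq_mul, bracket]
  fin_cases a <;> simp [eps, Fin.sum_univ_three] <;> ring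

/-- (II.41) written out as a matrix (indices `0,1,2`). [cite: MagnenRivasseauSeneor1993, (II.41) p.341] -/
theorem Tmat_eq (lam : ℝ) (γ : Fin 3 → ℝ) :
    Tmat lam γ = !![1, -(lam * γ 2), lam * γ 1; lam * γ 2, 1, -(lam * γ 0); -(lam * γ 1), lam * γ 0, 1] := by
  ext a b
  fin_cases a <;> fin_cases b <;> simp [Tmat, eps, Fin.sum_univ_three]

/-- `Σ_d γ_d²`. [cite: MagnenRivasseauSeneor1993, (II.42) p.341] -/
def normSq (γ : Fin 3 → ℝ) : ℝ := ∑ d, γ d ^ 2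

/-- `Σ_d γ_d²` written out. [cite: MagnenRivasseauSeneor1993, (II.42) p.341] -/
theorem normSq_eq (γ : Fin 3 → ℝ) : normSq γ = γ 0 ^ 2 + γ 1 ^ 2 + γ 2 ^ 2 := by
  simp [normSq, Fin.sum_univ_three]

/-- The prefactor of (II.42) never vanishes over `ℝ`: `0 < 1 + λ² Σ_d γ_d²`.
[cite: MagnenRivasseauSeneor1993, (II.42) p.341] -/
theorem one_add_sq_mul_normSq_pos (lam : ℝ) (γ : Fin 3 → ℝ) : 0 < 1 + lam ^ 2 * normSq γ := by
  have : 0 ≤ lam ^ 2 * normSq γ := by rw [normSq_eq]; positivity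
  linarith

/-- (II.42), the printed inverse: *«T⁻¹_ab = (1/(1 + λ² Σ_d γ_d²)) (δ_ab + ε_abc λγ_c + λ²γ_aγ_b)»*.
[cite: MagnenRivasseauSeneor1993, (II.42) p.341] -/
noncomputable def TinvMat (lam : ℝ) (γ : Fin 3 → ℝ) : Matrix (Fin 3) (Fin 3) ℝ :=
  Matrix.of fun a b =>
    (1 / (1 + lam ^ 2 * normSq γ)) * ((if a = b then 1 else 0) + ∑ c, eps a b c * lam * γ c + lam ^ 2 * γ a * γ b)

/-- (II.42) IS a right inverse of (II.41), for every real `λ`, `γ`. [cite: MagnenRivasseauSeneor1993, (II.41)–(II.42) p.341] -/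
theorem Tmat_mul_TinvMat (lam : ℝ) (γ : Fin 3 → ℝ) : Tmat lam γ * TinvMat lam γ = 1 := by
  have hD : 1 + lam ^ 2 * normSq γ ≠ 0 := (one_add_sq_mul_normSq_pos lam γ).ne'
  rw [normSq_eq] at hD
  ext a b
  fin_cases a <;> fin_cases b <;>
    simp [Tmat, TinvMat, Matrix.mul_apply, eps, Fin.sum_univ_three, normSq_eq] <;>
    field_simp <;> ring

/-- (II.42) IS a left inverse of (II.41), for every real `λ`, `γ`. [cite: MagnenRivasseauSeneor1993, (II.41)–(II.42) p.341] -/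
theorem TinvMat_mul_Tmat (lam : ℝ) (γ : Fin 3 → ℝ) : TinvMat lam γ * Tmat lam γ = 1 := by
  have hD : 1 + lam ^ 2 * normSq γ ≠ 0 := (one_add_sq_mul_normSq_pos lam γ).ne'
  rw [normSq_eq] at hD
  ext a b
  fin_cases a <;> fin_cases b <;>
    simp [Tmat, TinvMat, Matrix.mul_apply, eps, Fin.sum_univ_three, normSq_eq] <;>
    field_simp <;> ring

/-- Hence (II.42) is THE inverse of `T(γ)` in Mathlib's sense (`Matrix.inv`): the printed «the transformation
A → A^{γ,2} is invertible. The inversion formula … is a rational function of γ» (p.341 tl.15–17), linear piece.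
[cite: MagnenRivasseauSeneor1993, (II.42) p.341] -/
theorem Tmat_inv (lam : ℝ) (γ : Fin 3 → ℝ) : (Tmat lam γ)⁻¹ = TinvMat lam γ :=
  Matrix.inv_eq_right_inv (Tmat_mul_TinvMat lam γ)

/-- Inversion of the linear piece: `A = T⁻¹(A′)` whenever `A′ = T A` (the print's `A = T⁻¹(A′ − U)` with the
affine part `U` stripped). [cite: MagnenRivasseauSeneor1993, (II.42) p.341] -/
theorem mulVec_TinvMat_of_eq (lam : ℝ) (γ A A' : Fin 3 → ℝ) (h : A' = (Tmat lam γ).mulVec A) :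
    (TinvMat lam γ).mulVec A' = A := by
  rw [h, Matrix.mulVec_mulVec, TinvMat_mul_Tmat, Matrix.one_mulVec]

/-- `H` of (II.42): `T⁻¹ = δ + H`. [cite: MagnenRivasseauSeneor1993, (II.42) p.341] -/
noncomputable def Hmat (lam : ℝ) (γ : Fin 3 → ℝ) : Matrix (Fin 3) (Fin 3) ℝ := TinvMat lam γ - 1

/-- (II.42), last member: `T⁻¹_ab = δ_ab + H_ab`. [cite: MagnenRivasseauSeneor1993, (II.42) p.341] -/
theorem TinvMat_eq_one_add_Hmat (lam : ℝ) (γ : Fin 3 → ℝ) : TinvMat lam γ = 1 + Hmat lam γ := by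
  simp [Hmat]

/-- The explicit numerator of `H`: `H_ab = (λ ε_abc γ_c + λ²(γ_aγ_b − δ_ab Σ_dγ_d²)) / (1 + λ²Σ_dγ_d²)` — every
entry carries at least one factor `λγ`, which is the sense of «H is a small matrix» (p.341 tl.25) for `λγ` small.
[cite: MagnenRivasseauSeneor1993, (II.42) p.341] -/
theorem Hmat_eq (lam : ℝ) (γ : Fin 3 → ℝ) :
    Hmat lam γ = Matrix.of fun a b => (1 / (1 + lam ^ 2 * normSq γ)) *
      (∑ c, eps a b c * lam * γ c + lam ^ 2 * (γ a * γ b - (if a = b then 1 else 0) * normSq γ)) := by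
  have hD : 1 + lam ^ 2 * normSq γ ≠ 0 := (one_add_sq_mul_normSq_pos lam γ).ne'
  rw [normSq_eq] at hD
  ext a b
  fin_cases a <;> fin_cases b <;>
    simp [Hmat, TinvMat, eps, Fin.sum_univ_three, normSq_eq] <;>
    field_simp <;> ring_nf <;> simp

/-- At `γ = 0` (or `λ = 0`) there is nothing to invert: `H = 0`. [cite: MagnenRivasseauSeneor1993, (II.42) p.341] -/
theorem Hmat_zero (lam : ℝ) : Hmat lam 0 = 0 := by
  rw [Hmat_eq]
  ext a b
  fin_cases a <;> fin_cases b <;> simp [eps, normSq_eq]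

/-- The determinant of the linear piece `A ↦ TA`: `det T(γ) = 1 + λ² Σ_d γ_d²` (never `1` unless `λγ = 0` — the
printed «For the truncated gauge transformation this is no longer exactly true»).
[cite: MagnenRivasseauSeneor1993, (II.43) p.341] -/
theorem det_Tmat (lam : ℝ) (γ : Fin 3 → ℝ) : (Tmat lam γ).det = 1 + lam ^ 2 * normSq γ := by
  rw [Tmat_eq, Matrix.det_fin_three, normSq_eq]
  simp
  ring

/-- The printed Jacobian `J(γ) ≡ (1 + λ²γ²)⁻¹` (p.341 tl.30–31), `γ² = Σ_d γ_d²`.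
[cite: MagnenRivasseauSeneor1993, (II.43) p.341] -/
noncomputable def jacobianJ (lam : ℝ) (γ : Fin 3 → ℝ) : ℝ := (1 + lam ^ 2 * normSq γ)⁻¹

/-- `J(γ) = det T⁻¹`: the factor `Π_x(1 + λ²γ²(x))⁻¹` of (II.43) is, point by point, the determinant of the
inverse linear piece `A′ ↦ A = T⁻¹A′`, i.e. `dA = J(γ) dA′` as (II.43) prints.
[cite: MagnenRivasseauSeneor1993, (II.43) p.341] -/
theorem det_TinvMat_eq_jacobianJ (lam : ℝ) (γ : Fin 3 → ℝ) : (TinvMat lam γ).det = jacobianJ lam γ := by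
  have h : (Tmat lam γ).det * (TinvMat lam γ).det = 1 := by
    rw [← Matrix.det_mul, Tmat_mul_TinvMat, Matrix.det_one]
  rw [det_Tmat] at h
  have hD : 1 + lam ^ 2 * normSq γ ≠ 0 := (one_add_sq_mul_normSq_pos lam γ).ne'
  unfold jacobianJ
  field_simp
  linarith [h]

/-- `det T · J = 1`. [cite: MagnenRivasseauSeneor1993, (II.43) p.341] -/
theorem det_Tmat_mul_jacobianJ (lam : ℝ) (γ : Fin 3 → ℝ) : (Tmat lam γ).det * jacobianJ lam γ = 1 := by
  rw [det_Tmat, jacobianJ]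
  exact mul_inv_cancel₀ (one_add_sq_mul_normSq_pos lam γ).ne'

/-- `0 < J(γ) ≤ 1`, with `J = 1` iff `λγ = 0` («no longer exactly» one). [cite: MagnenRivasseauSeneor1993, (II.43) p.341] -/
theorem jacobianJ_pos_le_one (lam : ℝ) (γ : Fin 3 → ℝ) : 0 < jacobianJ lam γ ∧ jacobianJ lam γ ≤ 1 := by
  have h0 : 0 ≤ lam ^ 2 * normSq γ := by rw [normSq_eq]; positivity
  refine ⟨inv_pos.mpr (one_add_sq_mul_normSq_pos lam γ), ?_⟩
  unfold jacobianJ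
  exact inv_le_one_of_one_le₀ (by linarith)

end TruncatedGauge

/-! ## §su(2) (v1.1) The matrix conventions of Sect. II.A p.328 behind `bracket` -/

namespace Su2Conventions

open Matrix TruncatedGauge

/-- *«the three usual hermitian Pauli matrices»* `σ₁, σ₂, σ₃` (p.328 tl.26–28), indices `0,1,2`.
[cite: MagnenRivasseauSeneor1993, §II.A p.328] -/
def pauli : Fin 3 → Matrix (Fin 2) (Fin 2) ℂ
  | 0 => !![0, 1; 1, 0]
  | 1 => !![0, -Complex.I; Complex.I, 0]
  | 2 => !![1, 0; 0, -1]

/-- «hermitian». [cite: MagnenRivasseauSeneor1993, §II.A p.328] -/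
theorem pauli_conjTranspose (a : Fin 3) : (pauli a)ᴴ = pauli a := by
  fin_cases a <;>
  · ext i j; fin_cases i <;> fin_cases j <;> simp [pauli, Matrix.conjTranspose]

/-- The Pauli matrices are traceless (so `t_a ∈ su(2)`). [cite: MagnenRivasseauSeneor1993, §II.A p.328] -/
theorem pauli_trace (a : Fin 3) : (pauli a).trace = 0 := by
  fin_cases a <;> simp [pauli, Matrix.trace, Fin.sum_univ_two]

/-- The printed generators *«t_a = (iσ_a/2)»* (p.328 tl.26). [cite: MagnenRivasseauSeneor1993, §II.A p.328] -/
noncomputable def tgen (a : Fin 3) : Matrix (Fin 2) (Fin 2) ℂ := (Complex.I / 2) • pauli a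

/-- *«We have Tr t_a t_b = −δ_ab/2»* (p.328 tl.28–29) — exactly as printed. [cite: MagnenRivasseauSeneor1993, §II.A p.328] -/
theorem trace_tgen_mul (a b : Fin 3) :
    Matrix.trace (tgen a * tgen b) = -(if a = b then (1 : ℂ) else 0) / 2 := by
  fin_cases a <;> fin_cases b <;> simp [tgen, pauli, Matrix.trace, Fin.sum_univ_two] <;> ring_nf <;>
    simp [Complex.ext_iff] <;> norm_num

/-- PRECISION (ours): with `t_a = iσ_a/2` as printed, `[t_a, t_b] = −Σ_c ε_abc t_c` — structure constants `−ε`.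
[cite: MagnenRivasseauSeneor1993, §II.A p.328] -/
theorem tgen_commutator (a b : Fin 3) :
    tgen a * tgen b - tgen b * tgen a = -∑ c, ((eps a b c : ℝ) : ℂ) • tgen c := by
  fin_cases a <;> fin_cases b <;>
  · ext i j; fin_cases i <;> fin_cases j <;>
    simp [tgen, pauli, eps] <;> ring_nf <;>
    simp [Complex.ext_iff] <;> norm_num

/-- The generators with the other sign, `t′_a = σ_a/(2i) = −iσ_a/2` (NOT the printed ones), for comparison.
[cite: MagnenRivasseauSeneor1993, §II.A p.328] -/
noncomputable def tgen' (a : Fin 3) : Matrix (Fin 2) (Fin 2) ℂ := (-Complex.I / 2) • pauli a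

/-- With `t′_a = −iσ_a/2` the printed sign holds: `[t′_a, t′_b] = +Σ_c ε_abc t′_c`.
[cite: MagnenRivasseauSeneor1993, §II.A p.328] -/
theorem tgen'_commutator (a b : Fin 3) :
    tgen' a * tgen' b - tgen' b * tgen' a = ∑ c, ((eps a b c : ℝ) : ℂ) • tgen' c := by
  fin_cases a <;> fin_cases b <;>
  · ext i j; fin_cases i <;> fin_cases j <;>
    simp [tgen', pauli, eps] <;> ring_nf <;>
    simp [Complex.ext_iff] <;> norm_num

/-- *«A = Σ_{a=1}^{3} A^a t_a»* (p.328 tl.24–26): the su(2) matrix of a colour vector.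
[cite: MagnenRivasseauSeneor1993, §II.A p.328] -/
noncomputable def toSu2 (A : Fin 3 → ℝ) : Matrix (Fin 2) (Fin 2) ℂ := ∑ a, (A a : ℂ) • tgen a

/-- `Σ_a A^a t_a` written out. [cite: MagnenRivasseauSeneor1993, §II.A p.328] -/
theorem toSu2_eq (A : Fin 3 → ℝ) : toSu2 A =
    (Complex.I / 2) • !![(A 2 : ℂ), (A 0 : ℂ) - Complex.I * A 1; (A 0 : ℂ) + Complex.I * A 1, -(A 2 : ℂ)] := by
  ext i j; fin_cases i <;> fin_cases j <;>
    simp [toSu2, tgen, pauli, Fin.sum_univ_three, Matrix.sum_apply] <;> ring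

/-- PRECISION (ours, kernel-checked): for the printed `t_a = iσ_a/2` the matrix commutator is MINUS the printed
wedge product, `[A, B] = −Σ_c (ε_cab A^a B^b) t_c`; the sentence «[A^a_μ, A^b_ν] = ε^c_{ab} A^a_μ A^b_ν» (p.328
tl.32–33) carries the sign of `t′_a = −iσ_a/2` (equivalently `λ ↦ −λ` in (II.1)). Recorded, not adjudicated.
[cite: MagnenRivasseauSeneor1993, §II.A p.328] -/
theorem toSu2_commutator (A B : Fin 3 → ℝ) :
    toSu2 A * toSu2 B - toSu2 B * toSu2 A = -toSu2 (bracket A B) := by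
  rw [toSu2_eq, toSu2_eq, toSu2_eq]
  ext i j; fin_cases i <;> fin_cases j <;>
    simp [bracket, eps, Fin.sum_univ_three] <;> ring_nf <;>
    simp [Complex.ext_iff] <;> ring_nf

/-- The scalar product convention (p.328 tl.37–41): «minus a trace over group indices, so that it is positive
definite with a factor 1/2 in component notation» — `−Tr(AB) = ½ Σ_a A^a B^a` for the printed `t_a`.
[cite: MagnenRivasseauSeneor1993, §II.A p.328] -/
theorem neg_trace_toSu2_mul (A B : Fin 3 → ℝ) :
    -Matrix.trace (toSu2 A * toSu2 B) = (((1 / 2) * ∑ a, A a * B a : ℝ) : ℂ) := by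
  rw [toSu2_eq, toSu2_eq]
  apply Complex.ext <;> simp [Matrix.trace, Fin.sum_univ_two, Fin.sum_univ_three] <;> ring

/-- The integrand identity of (II.2): *«−½ ∫ d⁴x Tr F_μν F^μν = ¼ ∫ d⁴x Σ_a F^a_μν F^{μνa}»* — pointwise, for each
pair `μν`, `−½ Tr(F F) = ¼ Σ_a (F^a)²`. [cite: MagnenRivasseauSeneor1993, (II.2) p.328] -/
theorem actionDensity_II2 (F : Fin 3 → ℝ) :
    -(1 / 2) * Matrix.trace (toSu2 F * toSu2 F) = (((1 / 4) * ∑ a, F a ^ 2 : ℝ) : ℂ) := by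
  have h := neg_trace_toSu2_mul F F
  have : -(1 / 2) * Matrix.trace (toSu2 F * toSu2 F) = (1 / 2) * (-Matrix.trace (toSu2 F * toSu2 F)) := by ring
  rw [this, h]
  push_cast
  simp [Fin.sum_univ_three]
  ring

end Su2Conventions

end Literature.MathematicalPhysics.QuantumFieldTheory.MagnenRivasseauSeneor1993
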